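import Literature.NumberTheory.NumberFields.EquivariantIwasawaLemmaAbsolute
import Mathlib.FieldTheory.LinearDisjoint
import HarnessLib

/-!
# The equivariant Iwasawa lemma, V: composita `L₀ K_n` with an abelian `p`-tower `K_n`

Topic `NumberTheory/NumberFields` (namespace = path, grouping sub-namespace `EquivariantIwasawaLemma`).
THEOREM-ONLY file (no definition, no named fact, no `sorry`), written by the literature seat
`bsd-potss-conjA-anchor` g16 (cell `bsd-potss`; serves stmt-BirchSwinnertonDyer-19386 / 19413; closes
nothing; neither Conjecture A nor BSD is proved for any curve here).  Sequel of
`EquivariantIwasawaLemmaAbsolute.lean` (`equivariantHom_classGroup_eq_zero_tower`), specialised to the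
towers that occur: `L_n = L₀ K_n ⊆ k̄`, where `L₀/k` is finite Galois of degree prime to `p` and
`k = K₀ ⊆ K₁ ⊆ ⋯` are finite abelian extensions of `k` inside `k̄` with `[K_n : k] = pⁿ` (the layers
`ZpExtension.layer` of a `ℤ_p`-extension: tree `layer_zero`, `layer_mono`, `finrank_layer_holds`, `isAbelianGalois_layer`).  The Galois-theoretic layer hypotheses of the tower theorem are
DISCHARGED here — `[L_{n+1} : k] = p [L_n : k]` (linear disjointness from coprime degrees, Mathlib
`IntermediateField.LinearDisjoint.of_finrank_coprime`), `Gal(L_{n+1}/L_n)` central in `Gal(L_{n+1}/k)`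
(`Gal(k̄/L₀K) = Gal(k̄/L₀) ∩ Gal(k̄/K)`, Mathlib `IntermediateField.fixingSubgroup_sup`, and `Gal(K_{n+1}/k)`
abelian), `Γ_{L_n}` acts trivially — and the two RAMIFICATION hypotheses are restated with the extra
information a consumer has: an element `σ ∈ Γ_k` in the inertia group of a prime of `L_{n+1}` with
`σ|_{L₀} = 1`, `σ|_{K_n} = 1`, `σ|_{K_{n+1}} ≠ 1`.

## Result

* **`equivariantHom_classGroup_eq_zero_compositum_tower`** — with the data above, a `p`-torsion
  `Γ_k`-module `V` (`p` odd) on which `Γ_{L₀}` acts trivially, (c2*) `Hom_{Γ_k}(Cl(L₀), V) = 0`, and for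
  every `n`: (c3*)ₙ `V` has no non-zero vector fixed by the decomposition group
  `{τ ∈ Γ_k : τ|_{L_{n+1}} 𝔓 = 𝔓}` of any prime `𝔓` of `L_{n+1}` admitting such a `σ`, and one prime `𝔓₀` of
  `L_{n+1}` admitting such a `σ` with `p ∤ [Gal(L_{n+1}/k) : Stab(𝔓₀)]` ⟹ `Hom_{Γ_k}(Cl(L_n), V) = 0` for all
  `n`.  For `k = ℚ`, `L₀ = ℚ(E[p])` with `p ∤ #Gal(ℚ(E[p])/ℚ)`, `K_n = ℚ_n` and `V = E[p]` this is door L6 of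
  the cell's census modulo the two ramification inputs («`ℚ_{n+1}/ℚ_n` is ramified exactly above `p`,
  totally», tree `ZpExtension.inertia_le_kerSubgroup_holds` / `IsCyclotomic.inertia_sup_kerSubgroup_eq_top`,
  and (c3*) `E(ℚ_p)[p] = 0`), which are the consumer's.

## References

* L. C. Washington, *Introduction to Cyclotomic Fields*, 2nd ed., GTM 83 (1997), §13.3 Lemmas 13.14–13.15,
  Thm. 10.4. [Washington1997]
* J. Neukirch, *Algebraic Number Theory* (1999), Ch. VI (6.9), (7.1); Ch. IV §6. [NeukirchANT1999]
-/

noncomputable section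

open scoped Pointwise nonZeroDivisors
open NumberField Field IntermediateField Ideal
open Literature.NumberTheory.GaloisRepresentations

namespace Literature.NumberTheory.NumberFields

namespace EquivariantIwasawaLemma

section Compositum

variable {k : Type} [Field k]

/-- `((τ|_E) x : k̄) = τ • x`. [folklore] -/
private theorem coe_absRestrictNormalHom_apply'' (E : IntermediateField k (AlgebraicClosure k))
    [Normal k E] (τ : absoluteGaloisGroup k) (x : E) :
    ((absRestrictNormalHom E τ x : E) : AlgebraicClosure k) = τ • (x : AlgebraicClosure k) :=
  AlgEquiv.restrictNormalHom_apply E _ x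

/-- `τ|_E = 1` iff `τ ∈ Gal(k̄/E)` (Mathlib's `fixingSubgroup`, through the identification
`absoluteGaloisGroup.toAlgEquiv`). [folklore] -/
private theorem absRestrictNormalHom_eq_one_iff_mem_fixingSubgroup
    (E : IntermediateField k (AlgebraicClosure k)) [Normal k E] (τ : absoluteGaloisGroup k) :
    absRestrictNormalHom E τ = 1 ↔ absoluteGaloisGroup.toAlgEquiv k τ ∈ E.fixingSubgroup := by
  rw [IntermediateField.mem_fixingSubgroup_iff]
  constructor
  · intro h x hx
    change τ • x = x
    rw [← coe_absRestrictNormalHom_apply'' E τ ⟨x, hx⟩, h, AlgEquiv.one_apply]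
  · intro h
    ext x
    rw [coe_absRestrictNormalHom_apply'' E τ x, AlgEquiv.one_apply]
    exact h x x.2

/-- `τ|_{E₁E₂} = 1 ↔ τ|_{E₁} = 1 ∧ τ|_{E₂} = 1` (`Gal(k̄/E₁E₂) = Gal(k̄/E₁) ∩ Gal(k̄/E₂)`, Mathlib
`IntermediateField.fixingSubgroup_sup`). [folklore] -/
private theorem absRestrictNormalHom_sup_eq_one_iff (E₁ E₂ : IntermediateField k (AlgebraicClosure k))
    [Normal k E₁] [Normal k E₂] (τ : absoluteGaloisGroup k) :
    absRestrictNormalHom (E₁ ⊔ E₂ : IntermediateField k (AlgebraicClosure k)) τ = 1 ↔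
      absRestrictNormalHom E₁ τ = 1 ∧ absRestrictNormalHom E₂ τ = 1 := by
  rw [absRestrictNormalHom_eq_one_iff_mem_fixingSubgroup, absRestrictNormalHom_eq_one_iff_mem_fixingSubgroup,
    absRestrictNormalHom_eq_one_iff_mem_fixingSubgroup, IntermediateField.fixingSubgroup_sup,
    Subgroup.mem_inf]

/-- If `τ|_{E'} = 1` and `E ≤ E'` then `τ|_E = 1`. [folklore] -/
private theorem absRestrictNormalHom_eq_one_of_le' {E E' : IntermediateField k (AlgebraicClosure k)}
    [Normal k E] [Normal k E'] (h : E ≤ E') (τ : absoluteGaloisGroup k)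
    (hτ : absRestrictNormalHom E' τ = 1) : absRestrictNormalHom E τ = 1 := by
  rw [absRestrictNormalHom_eq_one_iff_mem_fixingSubgroup] at hτ ⊢
  exact IntermediateField.fixingSubgroup_antitone h hτ

/-- **`Gal(E₀E/E₀·)`-type centrality.**  If `Gal(E/k)` is abelian (`(στ)|_E = (τσ)|_E`) and `σ|_{E₀} = 1`,
then `(στ)|_{E₀E} = (τσ)|_{E₀E}`: the commutator is trivial on `E₀` (because `σ` is) and on `E`. [folklore] -/
private theorem absRestrictNormalHom_sup_mul_comm (E₀ E : IntermediateField k (AlgebraicClosure k))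
    [Normal k E₀] [Normal k E]
    (hE : ∀ σ τ : absoluteGaloisGroup k, absRestrictNormalHom E (σ * τ) = absRestrictNormalHom E (τ * σ))
    (σ τ : absoluteGaloisGroup k) (hσ : absRestrictNormalHom E₀ σ = 1) :
    absRestrictNormalHom (E₀ ⊔ E : IntermediateField k (AlgebraicClosure k)) (σ * τ) =
      absRestrictNormalHom (E₀ ⊔ E : IntermediateField k (AlgebraicClosure k)) (τ * σ) := by
  rw [← mul_inv_eq_one, ← map_inv, ← map_mul, absRestrictNormalHom_sup_eq_one_iff]
  constructor
  · rw [map_mul, map_inv, map_mul, map_mul, hσ, one_mul, mul_one, mul_inv_cancel]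
  · rw [map_mul, map_inv, hE σ τ, mul_inv_cancel]

variable [NumberField k]

set_option maxHeartbeats 1000000 in
set_option synthInstance.maxHeartbeats 100000 in
/-- **The equivariant Iwasawa lemma for the composita `L_n = L₀K_n`.**  `k` a number field, `p` an odd
prime; `L₀ ⊆ k̄` finite Galois over `k` with `p ∤ [L₀ : k]`; `K₀ = k ⊆ K₁ ⊆ K₂ ⊆ ⋯ ⊆ k̄` finite Galois over
`k` with ABELIAN groups (`IsAbelianGalois`) and `[K_n : k] = pⁿ`; `L_n := L₀ ⊔ K_n`.  `V` a `p`-torsion `Γ_k`-module on which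
`Γ_{L₀}` acts trivially, with (c2*) every additive `Γ_k`-equivariant `Cl(𝓞_{L₀}) → V` zero.  Assume for every
`n`: (c3*)ₙ for every prime `𝔓` of `L_{n+1}` for which some `σ ∈ Γ_k` has `σ|_{L_{n+1}}` in the inertia
group of `𝔓`, `σ|_{L₀} = 1`, `σ|_{K_n} = 1` and `σ|_{K_{n+1}} ≠ 1` («`𝔓` is ramified in `L_{n+1}/L_n`»), no
non-zero `v ∈ V` is fixed by `{τ ∈ Γ_k : τ|_{L_{n+1}} 𝔓 = 𝔓}`; and (orbit)ₙ one such prime `𝔓₀` has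
`p ∤ [Gal(L_{n+1}/k) : Stab(𝔓₀)]`.  Then for every `n` every additive `Γ_k`-equivariant `Cl(𝓞_{L_n}) → V`
is zero.  The Galois-theoretic hypotheses of `equivariantHom_classGroup_eq_zero_tower` are discharged
here: degrees by linear disjointness (coprime degrees), centrality of `Gal(L_{n+1}/L_n)` from
`Gal(k̄/L₀K) = Gal(k̄/L₀) ∩ Gal(k̄/K)` and the commutativity of `Gal(K_{n+1}/k)`.
[cite: Washington1997, §13.3 Lemmas 13.14–13.15 and Thm. 10.4 (proof)]
[cite: NeukirchANT1999, Ch. VI (6.9), (7.1) and Ch. IV §6 (equivariance of the Artin symbol)] -/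
theorem equivariantHom_classGroup_eq_zero_compositum_tower (p : ℕ) [Fact p.Prime] (hp2 : p ≠ 2)
    (L₀ : IntermediateField k (AlgebraicClosure k)) [FiniteDimensional k L₀] [IsGalois k L₀]
    (hL₀ : ¬ p ∣ Module.finrank k L₀)
    (K : ℕ → IntermediateField k (AlgebraicClosure k)) (hKmono : ∀ n, K n ≤ K (n + 1)) (hK0 : K 0 = ⊥)
    [∀ n, FiniteDimensional k (K n)] [hKab : ∀ n, IsAbelianGalois k (K n)]
    (hKdeg : ∀ n, Module.finrank k (K n) = p ^ n)
    [hNF : ∀ n, NumberField (L₀ ⊔ K n : IntermediateField k (AlgebraicClosure k))]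
    {V : Type*} [AddCommGroup V] [DistribMulAction (absoluteGaloisGroup k) V]
    (hpV : ∀ v : V, p • v = 0)
    (hV : ∀ τ : absoluteGaloisGroup k, absRestrictNormalHom L₀ τ = 1 → ∀ v : V, τ • v = v)
    (h0 : ∀ μ : Additive (ClassGroup (𝓞 L₀)) →+ V,
      (∀ (τ : absoluteGaloisGroup k) (c : ClassGroup (𝓞 L₀)),
        μ (Additive.ofMul (ClassGroup.mulEquiv
          (AmbiguousClass.intAut (absRestrictNormalHom L₀ τ)) c)) = τ • μ (Additive.ofMul c)) →
      μ = 0)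
    (hD : ∀ (n : ℕ) (𝔓 : Ideal (𝓞 (L₀ ⊔ K (n + 1) : IntermediateField k (AlgebraicClosure k))))
      [𝔓.IsMaximal],
      (∃ σ : absoluteGaloisGroup k,
        absRestrictNormalHom (L₀ ⊔ K (n + 1) : IntermediateField k (AlgebraicClosure k)) σ ∈
          𝔓.inertia ((L₀ ⊔ K (n + 1) : IntermediateField k (AlgebraicClosure k)) ≃ₐ[k]
            (L₀ ⊔ K (n + 1) : IntermediateField k (AlgebraicClosure k))) ∧
        absRestrictNormalHom L₀ σ = 1 ∧ absRestrictNormalHom (K n) σ = 1 ∧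
        absRestrictNormalHom (K (n + 1)) σ ≠ 1) →
      ∀ v : V, (∀ τ : absoluteGaloisGroup k,
        absRestrictNormalHom (L₀ ⊔ K (n + 1) : IntermediateField k (AlgebraicClosure k)) τ • 𝔓 = 𝔓 →
          τ • v = v) → v = 0)
    (horb : ∀ n : ℕ, ∃ (𝔓₀ : Ideal (𝓞 (L₀ ⊔ K (n + 1) : IntermediateField k (AlgebraicClosure k))))
      (_ : 𝔓₀.IsMaximal),
      (∃ σ : absoluteGaloisGroup k,
        absRestrictNormalHom (L₀ ⊔ K (n + 1) : IntermediateField k (AlgebraicClosure k)) σ ∈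
          𝔓₀.inertia ((L₀ ⊔ K (n + 1) : IntermediateField k (AlgebraicClosure k)) ≃ₐ[k]
            (L₀ ⊔ K (n + 1) : IntermediateField k (AlgebraicClosure k))) ∧
        absRestrictNormalHom L₀ σ = 1 ∧ absRestrictNormalHom (K n) σ = 1 ∧
        absRestrictNormalHom (K (n + 1)) σ ≠ 1) ∧
      ¬ p ∣ (MulAction.stabilizer ((L₀ ⊔ K (n + 1) : IntermediateField k (AlgebraicClosure k)) ≃ₐ[k]
        (L₀ ⊔ K (n + 1) : IntermediateField k (AlgebraicClosure k))) 𝔓₀).index)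
    (n : ℕ) (f : Additive (ClassGroup (𝓞 (L₀ ⊔ K n : IntermediateField k (AlgebraicClosure k)))) →+ V)
    (hf : ∀ (τ : absoluteGaloisGroup k)
        (c : ClassGroup (𝓞 (L₀ ⊔ K n : IntermediateField k (AlgebraicClosure k)))),
      f (Additive.ofMul (ClassGroup.mulEquiv (AmbiguousClass.intAut
        (absRestrictNormalHom (L₀ ⊔ K n : IntermediateField k (AlgebraicClosure k)) τ)) c)) =
        τ • f (Additive.ofMul c)) :
    f = 0 := by
  have hp : p.Prime := Fact.out
  haveI hKn : ∀ n, Normal k (K n) := fun n => inferInstance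
  have hKab' : ∀ (n : ℕ) (σ τ : absoluteGaloisGroup k),
      absRestrictNormalHom (K n) (σ * τ) = absRestrictNormalHom (K n) (τ * σ) := fun n σ τ => by
    rw [map_mul, map_mul]
    exact (hKab n).toIsMulCommutative.is_comm.comm _ _
  haveI hL₀n : Normal k L₀ := inferInstance
  -- the tower `L n = L₀ ⊔ K n`
  set L : ℕ → IntermediateField k (AlgebraicClosure k) := fun n => L₀ ⊔ K n with hLdef
  have hL : ∀ n, L n = L₀ ⊔ K n := fun n => rfl
  have hmono : ∀ n, L n ≤ L (n + 1) := fun n => sup_le_sup_left (hKmono n) L₀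
  have hLgal : ∀ n, IsGalois k (L n) := fun n => inferInstance
  haveI hLn : ∀ n, Normal k (L n) := fun n => (hLgal n).to_normal
  -- degrees: `[L₀ K_n : k] = [L₀ : k] pⁿ` (linear disjointness, coprime degrees)
  have hdegL : ∀ n, Module.finrank k (L n) = Module.finrank k L₀ * p ^ n := by
    intro n
    have hcop : (Module.finrank k L₀).Coprime (Module.finrank k (K n)) := by
      rw [hKdeg]
      exact (Nat.coprime_comm.mp (hp.coprime_iff_not_dvd.mpr hL₀)).pow_right n
    rw [hL, (IntermediateField.LinearDisjoint.of_finrank_coprime hcop).finrank_sup, hKdeg]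
  have hdeg : ∀ n, Module.finrank k (L (n + 1)) = p * Module.finrank k (L n) := by
    intro n
    rw [hdegL, hdegL, pow_succ]
    ring
  -- centrality
  have hcent : ∀ (n : ℕ) (σ τ : absoluteGaloisGroup k), absRestrictNormalHom (L n) σ = 1 →
      absRestrictNormalHom (L (n + 1)) (σ * τ) = absRestrictNormalHom (L (n + 1)) (τ * σ) := by
    intro n σ τ hσ
    exact absRestrictNormalHom_sup_mul_comm L₀ (K (n + 1)) (hKab' (n + 1)) σ τ
      (absRestrictNormalHom_eq_one_of_le' le_sup_left σ hσ)
  -- `Γ_{L 0}` acts trivially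
  have hV' : ∀ τ : absoluteGaloisGroup k, absRestrictNormalHom (L 0) τ = 1 → ∀ v : V, τ • v = v :=
    fun τ hτ => hV τ (absRestrictNormalHom_eq_one_of_le' le_sup_left τ hτ)
  -- (c2*) at `L 0 = L₀ ⊔ ⊥ = L₀`
  have hL0 : L 0 = L₀ := by rw [hL, hK0, sup_bot_eq]
  have h0' : ∀ (E : IntermediateField k (AlgebraicClosure k)), E = L₀ → ∀ [Normal k E],
      ∀ μ : Additive (ClassGroup (𝓞 E)) →+ V,
        (∀ (τ : absoluteGaloisGroup k) (c : ClassGroup (𝓞 E)),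
          μ (Additive.ofMul (ClassGroup.mulEquiv
            (AmbiguousClass.intAut (absRestrictNormalHom E τ)) c)) = τ • μ (Additive.ofMul c)) →
        μ = 0 := by
    rintro E rfl _ μ hμ
    exact h0 μ hμ
  -- ramification hypotheses in the form of the tower theorem
  have hram : ∀ (n : ℕ) (σ : absoluteGaloisGroup k), absRestrictNormalHom (L (n + 1)) σ ≠ 1 →
      absRestrictNormalHom (L n) σ = 1 →
      absRestrictNormalHom L₀ σ = 1 ∧ absRestrictNormalHom (K n) σ = 1 ∧
        absRestrictNormalHom (K (n + 1)) σ ≠ 1 := by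
    intro n σ hne h1
    obtain ⟨h0σ, hnσ⟩ := (absRestrictNormalHom_sup_eq_one_iff L₀ (K n) σ).mp h1
    refine ⟨h0σ, hnσ, fun h => hne ?_⟩
    exact (absRestrictNormalHom_sup_eq_one_iff L₀ (K (n + 1)) σ).mpr ⟨h0σ, h⟩
  have hram' : ∀ (n : ℕ) (σ : absoluteGaloisGroup k), absRestrictNormalHom L₀ σ = 1 →
      absRestrictNormalHom (K n) σ = 1 → absRestrictNormalHom (K (n + 1)) σ ≠ 1 →
      absRestrictNormalHom (L (n + 1)) σ ≠ 1 ∧ absRestrictNormalHom (L n) σ = 1 := by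
    intro n σ h0σ hnσ hne
    refine ⟨fun h => hne (absRestrictNormalHom_eq_one_of_le' le_sup_right σ h), ?_⟩
    exact (absRestrictNormalHom_sup_eq_one_iff L₀ (K n) σ).mpr ⟨h0σ, hnσ⟩
  refine equivariantHom_classGroup_eq_zero_tower (hGal := hLgal) p hp2 L hmono hdeg hcent hpV hV' ?_ ?_
    (h0' (L 0) hL0) n f hf
  · intro n 𝔓 _ hex v hv
    obtain ⟨σ, hI, hne, h1⟩ := hex
    obtain ⟨h0σ, hnσ, hne'⟩ := hram n σ hne h1
    exact hD n 𝔓 ⟨σ, hI, h0σ, hnσ, hne'⟩ v hv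
  · intro n
    obtain ⟨𝔓₀, h𝔓₀, ⟨σ, hI, h0σ, hnσ, hne⟩, hidx⟩ := horb n
    obtain ⟨hne', h1⟩ := hram' n σ h0σ hnσ hne
    exact ⟨𝔓₀, h𝔓₀, ⟨σ, hI, hne', h1⟩, hidx⟩

end Compositum

end EquivariantIwasawaLemma

end Literature.NumberTheory.NumberFields

end
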